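import Literature.RingTheory.NoetherNormalization.LinearFamily
import Literature.RingTheory.MvPolynomial.HilbertFunctionPolynomialExtension
import Mathlib.Algebra.MvPolynomial.Funext
import Mathlib.LinearAlgebra.FiniteDimensional.Lemmas
import Mathlib.LinearAlgebra.Matrix.NonsingularInverse
import HarnessLib

/-!
# Crux `RiemannWeightOne` (stmt-HodgeConjecture-16406), stub `stub_algebraisationSmooth`, part (N): a Noether normalisation adapted to a point derivation

Pure commutative algebra for the registered stub `stub_algebraisationSmooth` (Serre, GAGA §2 n°6).
Its analytic proof compares, at a complex point, the algebraic local ring with the germ of the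
manifold through a FINITE projection `t = (t₁, …, t_d) : X → 𝔸ᵈ` TRANSVERSAL at the point (the
differentials of the `tᵢ ∘ φ` span the cotangent space of the manifold). This file produces such `t`:

* `GenericNoether.isIntegral_shear` — the linear Noether normalisation step for ALL generic shears:
  if `F(w, s) = 0`, `F ≠ 0`, then for every `v` with `(dehomTop F)(v) ≠ 0` the element `w` is
  integral over `k[s₁ - v₁ w, …, s_d - v_d w]` (Greuel–Pfister Thm. 3.4.1, via the tree's
  `coeff_finSuccEquiv_linearChange_totalDegree`); `GenericNoether.exists_relation` — integral
  elements satisfy non-zero relations;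
* `GenericNoether.exists_forall_isIntegral_matrix` / `…_span` — for a `k`-linear point derivation
  `δ` at `e₀` (`δ(bc) = e₀(b) δ(c) + e₀(c) δ(b)`), `A` integral over `k[s]` and directions
  `w : Fin d → A`, there is `t : Fin d → A` with `A` integral over `k[t]` and an invertible matrix
  `E` with `δ(tᵢ) = Σ_l E_{l i} δ(w_l)`, so every `δ(w_l)` is a combination of the `δ(tᵢ)`: square
  the `sᵢ - e₀(sᵢ)` to kill their differentials, then shear successively by the `w_l` with
  coefficient vectors off the bad hypersurface AND off a hyperplane through the previous rows (a
  product of two non-zero polynomials over the infinite field `k` has a non-root).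

## References

* [GreuelPfister2002] G.-M. Greuel, G. Pfister, A Singular Introduction to Commutative Algebra
  (2002), Thm. 3.4.1 and its proof.
* [SerreGAGA1956] J.-P. Serre, GAGA, Ann. Inst. Fourier 6 (1956), §2 n°6.
-/

noncomputable section

set_option linter.dupNamespace false

namespace Summit.HodgeConjecture.HodgeConjecture.Theorems.RiemannWeightOne

namespace GenericNoether

open MvPolynomial Polynomial
open Literature.RingTheory.NoetherNormalization

variable {k : Type*} [Field k] {A : Type*} [CommRing A] [Algebra k A]

/-- A non-zero polynomial over an infinite field has a non-root. [folklore] -/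
theorem exists_eval_ne_zero [Infinite k] {σ : Type*} {p : MvPolynomial σ k} (hp : p ≠ 0) :
    ∃ v : σ → k, MvPolynomial.eval v p ≠ 0 := by
  by_contra h
  push Not at h
  exact hp (MvPolynomial.funext fun v => by rw [h v, map_zero])

/-- The linear form `y ↦ Σ rᵢ yᵢ` as a polynomial `Σ rᵢ Xᵢ`; it is non-zero if `r ≠ 0`. [folklore] -/
theorem linForm_ne_zero {d : ℕ} {r : Fin d → k} (hr : r ≠ 0) :
    (∑ i, MvPolynomial.C (r i) * MvPolynomial.X i : MvPolynomial (Fin d) k) ≠ 0 := by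
  obtain ⟨i₀, hi₀⟩ : ∃ i₀, r i₀ ≠ 0 := by
    by_contra h
    push Not at h
    exact hr (funext h)
  intro h0
  have h := congrArg (MvPolynomial.eval (Pi.single i₀ (1 : k))) h0
  rw [map_sum, map_zero, Finset.sum_eq_single i₀] at h
  · simp at h
    exact hi₀ h
  · intro j _ hj
    simp [hj]
  · simp

/-- Evaluating the linear form `Σ rᵢ Xᵢ`. [folklore] -/
theorem eval_linForm {d : ℕ} (r v : Fin d → k) :
    MvPolynomial.eval v (∑ i, MvPolynomial.C (r i) * MvPolynomial.X i : MvPolynomial (Fin d) k) =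
      ∑ i, r i * v i := by
  rw [map_sum]
  exact Finset.sum_congr rfl fun i _ => by simp

/-- **Linear Noether normalisation step, for every generic shear** (Greuel–Pfister 2002, proof of
Thm. 3.4.1 (5)): if `y₀, …, y_N ∈ A` satisfy a non-zero relation `F(y) = 0` of degree `D`, then
for EVERY `v ∈ kᴺ` with `F_D(1, v) ≠ 0` (`(dehomTop F)(v) ≠ 0`) the element `y₀` is integral over
`k[y₁ - v₁ y₀, …, y_N - v_N y₀]`: after the shear `X_{i+1} ↦ X_{i+1} + vᵢ X₀` the relation has
leading coefficient the non-zero constant `F_D(1, v)` in `X₀`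
(`coeff_finSuccEquiv_linearChange_totalDegree`). [cite: GreuelPfister2002, Thm. 3.4.1 (proof)] -/
theorem isIntegral_shear {N : ℕ} (y₀ : A) (y : Fin N → A) {F : MvPolynomial (Fin (N + 1)) k}
    (hFy : MvPolynomial.aeval (Fin.cons y₀ y : Fin (N + 1) → A) F = 0) (v : Fin N → k)
    (hv : MvPolynomial.eval v (dehomTop F) ≠ 0) :
    IsIntegral (Algebra.adjoin k (Set.range fun i : Fin N => y i - v i • y₀)) y₀ := by
  -- adapted from `Literature.RingTheory.NoetherNormalization.exists_shear_isIntegral`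
  set c : k := MvPolynomial.eval (Fin.cons 1 v) (homogeneousComponent F.totalDegree F) with hc
  have hc0 : c ≠ 0 := by rwa [hc, ← eval_dehomTop]
  -- the sheared relation is `C c · (monic)` in `X₀`
  set P := finSuccEquiv k N (linearChange v F) with hP
  have hcoeff : P.coeff F.totalDegree = MvPolynomial.C c :=
    coeff_finSuccEquiv_linearChange_totalDegree v F
  have hle : P.natDegree ≤ F.totalDegree := by
    rw [hP, ← toPolyChange_eq]; exact natDegree_toPolyChange_le v F
  have hne : P.coeff F.totalDegree ≠ 0 := by
    rw [hcoeff]; exact (map_ne_zero_iff _ (MvPolynomial.C_injective _ _)).2 hc0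
  have hdeg : P.natDegree = F.totalDegree := le_antisymm hle (Polynomial.le_natDegree_of_ne_zero hne)
  have hmul : finSuccEquiv k N (linearChange v (MvPolynomial.C c⁻¹ * F)) =
      Polynomial.C (MvPolynomial.C c⁻¹) * P := by
    rw [map_mul, map_mul, MvPolynomial.algHom_C, MvPolynomial.algebraMap_eq, hP]
    congr 1
    rw [finSuccEquiv_apply, eval₂Hom_C]
    rfl
  have hu : IsUnit (MvPolynomial.C c⁻¹ : MvPolynomial (Fin N) k) :=
    (isUnit_iff_ne_zero.2 (inv_ne_zero hc0)).map MvPolynomial.C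
  have hmonic : (Polynomial.C (MvPolynomial.C c⁻¹) * P).Monic := by
    rw [Polynomial.Monic, Polynomial.leadingCoeff_C_mul_of_isUnit hu,
      Polynomial.leadingCoeff, hdeg, hcoeff, ← map_mul, inv_mul_cancel₀ hc0, map_one]
  set G := Polynomial.C (MvPolynomial.C c⁻¹) * P with hG
  set y' : Fin N → A := fun i => y i - v i • y₀ with hy'
  set B' : Subalgebra k A := Algebra.adjoin k (Set.range y') with hB'
  let wB : Fin N → B' := fun i => ⟨y' i, Algebra.subset_adjoin ⟨i, rfl⟩⟩
  let ψ : MvPolynomial (Fin N) k →ₐ[k] B' := MvPolynomial.aeval wB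
  have hψ : (algebraMap B' A).comp (ψ : MvPolynomial (Fin N) k →+* B') =
      (MvPolynomial.aeval y' : MvPolynomial (Fin N) k →ₐ[k] A).toRingHom := by
    have h : ((Algebra.ofId B' A).restrictScalars k).comp ψ = MvPolynomial.aeval y' := by
      refine MvPolynomial.algHom_ext fun i => ?_
      simp [ψ, wB]
    exact congrArg AlgHom.toRingHom h
  refine ⟨G.map (ψ : MvPolynomial (Fin N) k →+* B'), hmonic.map _, ?_⟩
  rw [Polynomial.eval₂_map, hψ]
  change Polynomial.aevalTower (MvPolynomial.aeval y' : MvPolynomial (Fin N) k →ₐ[k] A) y₀ G = 0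
  rw [← hmul, ← aeval_finCons_eq_aevalTower_finSuccEquiv]
  have hcomp : (MvPolynomial.aeval (Fin.cons y₀ y' : Fin (N + 1) → A)).comp (linearChange v) =
      MvPolynomial.aeval (Fin.cons y₀ y : Fin (N + 1) → A) := by
    refine MvPolynomial.algHom_ext fun i => ?_
    refine Fin.cases ?_ (fun j => ?_) i
    · simp
    · rw [AlgHom.comp_apply, linearChange_X_succ, map_add, map_mul, MvPolynomial.aeval_X,
        MvPolynomial.aeval_X, MvPolynomial.aeval_X, MvPolynomial.algHom_C, Fin.cons_succ,
        Fin.cons_zero, Fin.cons_succ, Algebra.algebraMap_eq_smul_one, smul_mul_assoc, one_mul, hy']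
      simp only [sub_add_cancel]
  have := congrArg (fun g : MvPolynomial (Fin (N + 1)) k →ₐ[k] A => g (MvPolynomial.C c⁻¹ * F)) hcomp
  simp only [AlgHom.comp_apply] at this
  rw [this, map_mul, hFy, mul_zero]

/-- **An integral element satisfies a non-zero polynomial relation**: if `w` is integral over
`k[s₁, …, s_d]` then `F(w, s) = 0` for some `F ≠ 0` (lift the coefficients of a monic equation to
polynomials in the `sᵢ`; `F` is monic in `X₀`, hence non-zero). [folklore] -/
theorem exists_relation {d : ℕ} (s : Fin d → A) {w : A}
    (hw : IsIntegral (Algebra.adjoin k (Set.range s)) w) :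
    ∃ F : MvPolynomial (Fin (d + 1)) k, F ≠ 0 ∧
      MvPolynomial.aeval (Fin.cons w s : Fin (d + 1) → A) F = 0 := by
  set B' := Algebra.adjoin k (Set.range s) with hB'
  obtain ⟨f, hfm, hfw⟩ := hw
  -- lift the coefficients
  have hlift : ∀ j : ℕ, ∃ q : MvPolynomial (Fin d) k,
      MvPolynomial.aeval s q = ((f.coeff j : B') : A) := fun j => by
    have hmem : ((f.coeff j : B') : A) ∈ (MvPolynomial.aeval s : MvPolynomial (Fin d) k →ₐ[k] A).range := by
      rw [← Algebra.adjoin_range_eq_range_aeval]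
      exact (f.coeff j).2
    exact hmem
  choose q₀ hq₀ using hlift
  set q : ℕ → MvPolynomial (Fin d) k := fun j => if j = f.natDegree then 1 else q₀ j with hqdef
  have hq : ∀ j, MvPolynomial.aeval s (q j) = ((f.coeff j : B') : A) := fun j => by
    by_cases hj : j = f.natDegree
    · rw [hqdef]
      simp only [hj, if_true, map_one, Polynomial.Monic.coeff_natDegree hfm]
      rfl
    · rw [hqdef]
      simp only [hj, if_false, hq₀]
  -- the relation `F = Σ_j q_j(X₁, …, X_d) X₀^j`
  set F : MvPolynomial (Fin (d + 1)) k :=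
    ∑ j : Fin (f.natDegree + 1), MvPolynomial.rename Fin.succ (q j) * MvPolynomial.X 0 ^ (j : ℕ)
    with hF
  have hcoeffF : ∀ j : Fin (f.natDegree + 1), (finSuccEquiv k d F).coeff j = q j :=
    Literature.RingTheory.MvPolynomial.coeff_finSuccEquiv_sum_rename_mul_X_pow
      (fun j : Fin (f.natDegree + 1) => q j)
  refine ⟨F, fun h0 => ?_, ?_⟩
  · -- the coefficient of `X₀^{deg f}` is `q_{deg f}`, which lifts the leading coefficient `1`
    have h1 := hcoeffF ⟨f.natDegree, Nat.lt_succ_self _⟩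
    rw [h0, map_zero, Polynomial.coeff_zero, hqdef] at h1
    simp at h1
  · -- `F(w, s) = Σ_j q_j(s) w^j = f(w) = 0`
    rw [hF, map_sum]
    have hterm : ∀ j : Fin (f.natDegree + 1),
        MvPolynomial.aeval (Fin.cons w s : Fin (d + 1) → A)
          (MvPolynomial.rename Fin.succ (q j) * MvPolynomial.X 0 ^ (j : ℕ)) =
        ((f.coeff j : B') : A) * w ^ (j : ℕ) := fun j => by
      rw [map_mul, map_pow, MvPolynomial.aeval_X, Fin.cons_zero, MvPolynomial.aeval_rename]
      have : (Fin.cons w s : Fin (d + 1) → A) ∘ Fin.succ = s := funext fun i => by simp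
      rw [this, hq]
    simp_rw [hterm]
    rw [Fin.sum_univ_eq_sum_range (fun i => ((f.coeff i : B') : A) * w ^ i) (f.natDegree + 1)]
    rw [Polynomial.eval₂_eq_sum_range] at hfw
    have hcoe : ∀ i, (algebraMap B' A) (f.coeff i) = ((f.coeff i : B') : A) := fun i => rfl
    simp_rw [hcoe] at hfw
    exact hfw

section Derivation

variable {V : Type*} [AddCommGroup V] [Module k V] (δ : A →ₗ[k] V) (e₀ : A →ₐ[k] k)
  (hδ : ∀ b c, δ (b * c) = e₀ b • δ c + e₀ c • δ b)
include hδ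

/-- A point derivation kills `1`. [folklore] -/
theorem derivation_one : δ 1 = 0 := by
  have h := hδ 1 1
  rw [mul_one, show e₀ 1 = 1 from map_one e₀, one_smul] at h
  simpa using h

/-- A point derivation kills squares of elements vanishing at the point. [folklore] -/
theorem derivation_sq_sub (b : A) : δ ((b - algebraMap k A (e₀ b)) * (b - algebraMap k A (e₀ b))) = 0 := by
  rw [hδ]
  have : e₀ (b - algebraMap k A (e₀ b)) = 0 := by simp
  rw [this, zero_smul, zero_add]

end Derivation

/-- If `A` is integral over `k[s]` then `A` is integral over `k[(s - c)²]` for any constants `cᵢ`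
(`sᵢ - cᵢ` is a root of `X² - (sᵢ - cᵢ)²`). [folklore] -/
theorem forall_isIntegral_sq {d : ℕ} (s : Fin d → A) (c : Fin d → k)
    (hs : ∀ b : A, IsIntegral (Algebra.adjoin k (Set.range s)) b) :
    ∀ b : A, IsIntegral (Algebra.adjoin k (Set.range fun i =>
      (s i - algebraMap k A (c i)) * (s i - algebraMap k A (c i)))) b := by
  set s' : Fin d → A := fun i => (s i - algebraMap k A (c i)) * (s i - algebraMap k A (c i)) with hs'
  set B' := Algebra.adjoin k (Set.range s') with hB'
  -- each `sᵢ` is integral over `B'`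
  have hsi : ∀ i, IsIntegral B' (s i) := fun i => by
    have hmem : s' i ∈ B' := Algebra.subset_adjoin ⟨i, rfl⟩
    have h1 : IsIntegral B' (s i - algebraMap k A (c i)) := by
      refine ⟨Polynomial.X ^ 2 - Polynomial.C ⟨s' i, hmem⟩, Polynomial.monic_X_pow_sub_C _ two_ne_zero, ?_⟩
      simp only [Polynomial.eval₂_sub, Polynomial.eval₂_X_pow, Polynomial.eval₂_C]
      rw [show (algebraMap B' A) ⟨s' i, hmem⟩ = s' i from rfl, hs']
      ring
    have h2 : IsIntegral B' (algebraMap k A (c i)) := by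
      rw [IsScalarTower.algebraMap_apply k B' A]
      exact isIntegral_algebraMap
    simpa using h1.add h2
  intro b
  refine isIntegral_of_isIntegral_adjoin (fun x hx => ?_) (hs b)
  obtain ⟨i, rfl⟩ := hx
  exact hsi i

section Shears

variable {V : Type*} [AddCommGroup V] [Module k V]
  (δ : A →ₗ[k] V) (e₀ : A →ₐ[k] k) (hδ : ∀ b c, δ (b * c) = e₀ b • δ c + e₀ c • δ b)

/-- **After one shear the algebra stays integral.** If `A` is integral over `k[t]` and `w` is
integral over `k[t - v • w]`, then `A` is integral over `k[t - v • w]` (each `tᵢ = (tᵢ - vᵢ w) + vᵢ w`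
is integral over it). [folklore] -/
theorem forall_isIntegral_shear {d : ℕ} (t : Fin d → A) (w : A) (v : Fin d → k)
    (ht : ∀ b : A, IsIntegral (Algebra.adjoin k (Set.range t)) b)
    (hw : IsIntegral (Algebra.adjoin k (Set.range fun i => t i - v i • w)) w) :
    ∀ b : A, IsIntegral (Algebra.adjoin k (Set.range fun i => t i - v i • w)) b := by
  set B' := Algebra.adjoin k (Set.range fun i => t i - v i • w) with hB'
  have hti : ∀ i, IsIntegral B' (t i) := fun i => by
    have hmem : t i - v i • w ∈ B' := Algebra.subset_adjoin ⟨i, rfl⟩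
    have h1 : IsIntegral B' (t i - v i • w) := isIntegral_algebraMap (x := (⟨_, hmem⟩ : B'))
    have h2 : IsIntegral B' (v i • w) := by
      have : v i • w = algebraMap k A (v i) * w := Algebra.smul_def _ _
      rw [this]
      refine IsIntegral.mul ?_ hw
      rw [IsScalarTower.algebraMap_apply k B' A]
      exact isIntegral_algebraMap
    simpa using h1.add h2
  intro b
  refine isIntegral_of_isIntegral_adjoin (fun x hx => ?_) (ht b)
  obtain ⟨i, rfl⟩ := hx
  exact hti i

/-- **The inductive construction.** Given `t` with `A` integral over `k[t]`, `δ(tᵢ) = 0`, and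
directions `w₁, …, w_d`, for every `j ≤ d` there are `t'` with `A` integral over `k[t']` and `j`
linearly independent rows `E_l ∈ kᵈ` with `δ(t'ᵢ) = Σ_{l<j} E_{l i} δ(w_l)`: shear successively by
`w₁, …, w_j` with generic coefficient vectors (`isIntegral_shear`), chosen moreover off a hyperplane
containing the previous rows. [cite: GreuelPfister2002, Thm. 3.4.1 (proof)] -/
theorem exists_forall_isIntegral_rows [Infinite k] {d : ℕ} (w : Fin d → A) (t₀ : Fin d → A)
    (ht₀ : ∀ b : A, IsIntegral (Algebra.adjoin k (Set.range t₀)) b) (ht₀δ : ∀ i, δ (t₀ i) = 0) :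
    ∀ j : ℕ, ∀ hj : j ≤ d, ∃ t : Fin d → A, (∀ b : A, IsIntegral (Algebra.adjoin k (Set.range t)) b) ∧
      ∃ E : Fin j → (Fin d → k), LinearIndependent k E ∧
        ∀ i, δ (t i) = ∑ l : Fin j, E l i • δ (w (Fin.castLE hj l)) := by
  intro j
  induction j with
  | zero =>
    intro _
    exact ⟨t₀, ht₀, fun l => l.elim0, linearIndependent_empty_type, fun i => by simp [ht₀δ i]⟩
  | succ j ih =>
    intro hj
    obtain ⟨t, ht, E, hE, hδt⟩ := ih (Nat.le_of_succ_le hj)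
    set w' : A := w ⟨j, hj⟩ with hw'
    -- a non-zero relation `F(w', t) = 0`
    obtain ⟨F, hF0, hF⟩ := exists_relation t (ht w')
    -- a non-zero vector `r` orthogonal to the previous rows
    have hjd : j < d := hj
    let L : (Fin d → k) →ₗ[k] (Fin j → k) :=
      { toFun := fun x l => ∑ i, E l i * x i
        map_add' := fun x y => funext fun l => by
          simp only [Pi.add_apply, mul_add, Finset.sum_add_distrib]
        map_smul' := fun c x => funext fun l => by
          simp only [Pi.smul_apply, smul_eq_mul, RingHom.id_apply, Finset.mul_sum]
          exact Finset.sum_congr rfl fun i _ => by ring }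
    have hker : LinearMap.ker L ≠ ⊥ := LinearMap.ker_ne_bot_of_finrank_lt (by simpa using hjd)
    obtain ⟨r, hrL, hr0⟩ := Submodule.exists_mem_ne_zero_of_ne_bot hker
    have hrE : ∀ l, ∑ i, E l i * r i = 0 := fun l => congrFun (LinearMap.mem_ker.1 hrL) l
    -- a generic coefficient vector: off the bad hypersurface and with `Σ rᵢ vᵢ ≠ 0`
    have hprod : dehomTop F * (∑ i, MvPolynomial.C (r i) * MvPolynomial.X i) ≠ 0 :=
      mul_ne_zero (dehomTop_ne_zero hF0) (linForm_ne_zero hr0)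
    obtain ⟨v, hv⟩ := exists_eval_ne_zero hprod
    rw [map_mul, mul_ne_zero_iff, eval_linForm] at hv
    obtain ⟨hv1, hv2⟩ := hv
    set t' : Fin d → A := fun i => t i - v i • w' with ht'
    have hw'int : IsIntegral (Algebra.adjoin k (Set.range t')) w' := isIntegral_shear w' t hF v hv1
    refine ⟨t', forall_isIntegral_shear t w' v ht hw'int, Fin.snoc E (-v), ?_, fun i => ?_⟩
    · -- independence of the rows: `-v` is off the span of the previous rows, which lies in `r⊥`
      rw [linearIndependent_finSnoc]
      refine ⟨hE, fun hmem => hv2 ?_⟩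
      have hperp : ∀ x ∈ Submodule.span k (Set.range E), ∑ i, r i * x i = 0 := by
        intro x hx
        refine Submodule.span_induction ?_ ?_ ?_ ?_ hx
        · rintro _ ⟨l, rfl⟩
          rw [← hrE l]
          exact Finset.sum_congr rfl fun i _ => mul_comm _ _
        · simp
        · intro x y _ _ hx hy
          simp only [Pi.add_apply, mul_add, Finset.sum_add_distrib, hx, hy, add_zero]
        · intro c x _ hx
          simp only [Pi.smul_apply, smul_eq_mul]
          rw [show ∑ i, r i * (c * x i) = c * ∑ i, r i * x i from by
            rw [Finset.mul_sum]; exact Finset.sum_congr rfl fun i _ => by ring, hx, mul_zero]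
      have h := hperp _ hmem
      simp only [Pi.neg_apply, mul_neg, Finset.sum_neg_distrib, neg_eq_zero] at h
      exact h
    · -- the differentials
      rw [ht']
      simp only [map_sub, map_smul, hδt i, Fin.sum_univ_castSucc, Fin.snoc_castSucc, Fin.snoc_last,
        Pi.neg_apply, neg_smul]
      rw [sub_eq_add_neg]
      congr 1

include hδ in
/-- **Noether normalisation adapted to a point derivation** (matrix form). Let `δ : A → V` be a
`k`-linear point derivation at `e₀`, `A` integral over `k[s₁, …, s_d]`, and `w₁, …, w_d ∈ A`. Then
there are `t₁, …, t_d` with `A` integral over `k[t]` and an invertible `d × d` matrix `E` over `k`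
with `δ(tᵢ) = Σ_l E_{l i} δ(w_l)`. (Square the `sᵢ - e₀(sᵢ)` to kill their differentials, then
`exists_forall_isIntegral_rows` with `j = d`.) [cite: GreuelPfister2002, Thm. 3.4.1 (proof)] -/
theorem exists_forall_isIntegral_matrix [Infinite k] {d : ℕ} (w : Fin d → A) (s : Fin d → A)
    (hs : ∀ b : A, IsIntegral (Algebra.adjoin k (Set.range s)) b) :
    ∃ t : Fin d → A, (∀ b : A, IsIntegral (Algebra.adjoin k (Set.range t)) b) ∧
      ∃ E : Matrix (Fin d) (Fin d) k, IsUnit E ∧ ∀ i, δ (t i) = ∑ l, E l i • δ (w l) := by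
  classical
  set t₀ : Fin d → A := fun i => (s i - algebraMap k A (e₀ (s i))) * (s i - algebraMap k A (e₀ (s i)))
    with ht₀
  have ht₀int := forall_isIntegral_sq s (fun i => e₀ (s i)) hs
  have ht₀δ : ∀ i, δ (t₀ i) = 0 := fun i => derivation_sq_sub δ e₀ hδ (s i)
  obtain ⟨t, ht, E, hE, hδt⟩ := exists_forall_isIntegral_rows δ w t₀ ht₀int ht₀δ d le_rfl
  refine ⟨t, ht, Matrix.of E, ?_, fun i => ?_⟩
  · exact Matrix.linearIndependent_rows_iff_isUnit.1 hE
  · rw [hδt i]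
    exact Finset.sum_congr rfl fun l _ => by simp

include hδ in
/-- **Noether normalisation adapted to a point derivation** (spanning form): with `t` as in
`exists_forall_isIntegral_matrix`, every `δ(w_l)` is a `k`-linear combination of the `δ(tᵢ)`
(invert `E`). In the application `δ` is the differential at a point of a complex manifold and the
`δ(w_l)` span the cotangent space, so `(t₁ ∘ φ, …, t_d ∘ φ)` is an immersion there.
[cite: GreuelPfister2002, Thm. 3.4.1 (proof)] -/
theorem exists_forall_isIntegral_span [Infinite k] {d : ℕ} (w : Fin d → A) (s : Fin d → A)
    (hs : ∀ b : A, IsIntegral (Algebra.adjoin k (Set.range s)) b) :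
    ∃ t : Fin d → A, (∀ b : A, IsIntegral (Algebra.adjoin k (Set.range t)) b) ∧
      ∀ l, δ (w l) ∈ Submodule.span k (Set.range fun i => δ (t i)) := by
  classical
  obtain ⟨t, ht, E, hEu, hδt⟩ := exists_forall_isIntegral_matrix δ e₀ hδ w s hs
  refine ⟨t, ht, fun m => ?_⟩
  -- `δ(w_m) = Σ_i (E⁻¹)_{i m} δ(t_i)`
  have key : ∑ i, E⁻¹ i m • δ (t i) = δ (w m) := by
    simp_rw [hδt, Finset.smul_sum, smul_smul]
    rw [Finset.sum_comm]
    have hmul : ∀ l, ∑ i, E⁻¹ i m * E l i = (E * E⁻¹) l m := fun l => by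
      rw [Matrix.mul_apply]
      exact Finset.sum_congr rfl fun i _ => mul_comm _ _
    simp_rw [← Finset.sum_smul, hmul, Matrix.mul_nonsing_inv E ((Matrix.isUnit_iff_isUnit_det E).1 hEu),
      Matrix.one_apply, ite_smul, one_smul, zero_smul, Finset.sum_ite_eq', Finset.mem_univ, if_true]
  rw [← key]
  exact Submodule.sum_mem _ fun i _ => Submodule.smul_mem _ _ (Submodule.subset_span ⟨i, rfl⟩)

end Shears

end GenericNoether

/-- **Registered sub-goal `stub_algebraisationSmooth_genericNoether`** of the stub
`stub_algebraisationSmooth` (part (N): Noether normalisation adapted to a point derivation,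
`GenericNoether.exists_forall_isIntegral_span`). [cite: GreuelPfister2002, Thm. 3.4.1 (proof)] -/
theorem stub_algebraisationSmooth_genericNoether :
    ∀ ⦃k : Type⦄ [Field k] [Infinite k] ⦃A : Type⦄ [CommRing A] [Algebra k A] ⦃V : Type⦄
      [AddCommGroup V] [Module k V] (δ : A →ₗ[k] V) (e₀ : A →ₐ[k] k),
      (∀ b c, δ (b * c) = e₀ b • δ c + e₀ c • δ b) → ∀ ⦃d : ℕ⦄ (w s : Fin d → A),
      (∀ b : A, IsIntegral (Algebra.adjoin k (Set.range s)) b) →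
      ∃ t : Fin d → A, (∀ b : A, IsIntegral (Algebra.adjoin k (Set.range t)) b) ∧
        ∀ l, δ (w l) ∈ Submodule.span k (Set.range fun i => δ (t i)) :=
  fun _ _ _ _ _ _ _ _ _ δ e₀ hδ _ w s hs => GenericNoether.exists_forall_isIntegral_span δ e₀ hδ w s hs

end Summit.HodgeConjecture.HodgeConjecture.Theorems.RiemannWeightOne

end
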